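import Summits.Ventures.HodgeRepro2.T5SU11ResolventEnergy

/-!
# The resolvent bound `‖G_λ f‖ ≤ ‖f‖ / (λ(λ−2))` in `L²(sinh 2t dt)` for `λ > 2`

From the energy identity of row 475, `∫_0^∞ sinh 2t (u′)² + μ ∫_0^∞ sinh 2t u² = −∫_a^b sinh 2t f u` for `u = G_λ f`,
`μ = λ(λ−2)`, and the pointwise inequality `−2μ f u ≤ μ² u² + f²` (`neg_two_mul_mul_le`):
`2μ² ∫ sinh 2t u² ≤ −2μ ∫_a^b sinh 2t f u ≤ μ² ∫_a^b sinh 2t u² + ∫_a^b sinh 2t f² ≤ μ² ∫_0^∞ sinh 2t u² + ∫_a^b sinh 2t f²`,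
hence for `λ > 2` (`μ > 0`)

  **`∫_0^∞ sinh 2t (G_λ f)² ≤ (∫_a^b sinh 2t f²) / (λ(λ−2))²`**  (`integral_sinh_mul_sphGreen_sq_le`),

i.e. `‖G_λ f‖ ≤ ‖f‖/μ` — the resolvent `(L − μ)⁻¹` of the radial Laplacian has norm at most `1/μ` on compactly
supported sources, as it must for the non-positive operator `L` (`‖(L − μ)⁻¹‖ ≤ 1/dist(μ, spec L)` with `spec L ⊂
(−∞, 0]`). Also the source norm as an integral over `(0, ∞)` (`integral_Ioi_sinh_mul_sq_eq`). Nothing is claimed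
about (N).

Blind lane: Mathlib + the HodgeRepro2 prefix only; no sorry; axioms ⊆ {propext, Classical.choice,
Quot.sound}.
-/

namespace Summit.Ventures.HodgeRepro2.T5SU11ResolventBound

open Filter Topology MeasureTheory intervalIntegral
open Set (Ioi Ioc Icc)
open T5SU11Cartan T5SU11SphericalFunction T5SU11SphericalGreen T5SU11ResolventEnergyPieces T5SU11ResolventEnergy

/-- The pointwise inequality `−2μ x y ≤ μ² y² + x²` (from `(μ y + x)² ≥ 0`). -/
theorem neg_two_mul_mul_le (μ x y : ℝ) : -(2 * μ) * (x * y) ≤ μ ^ 2 * y ^ 2 + x ^ 2 := by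
  nlinarith [sq_nonneg (μ * y + x)]

/-- The source norm `∫_0^∞ sinh 2t f²` is the integral over `[a, b]`. -/
theorem integral_Ioi_sinh_mul_sq_eq {a b : ℝ} {f : ℝ → ℝ} (ha : 0 < a) (hab : a ≤ b)
    (hfa : ∀ s, s ≤ a → f s = 0) (hfb : ∀ s, b ≤ s → f s = 0) :
    ∫ t in Ioi 0, Real.sinh (2 * t) * f t ^ 2 = ∫ t in a..b, Real.sinh (2 * t) * f t ^ 2 := by
  rw [integral_of_le hab]
  refine setIntegral_eq_of_subset_of_forall_sdiff_eq_zero measurableSet_Ioi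
    (fun t ht => lt_of_lt_of_le ha ht.1.le) ?_
  intro t ht
  rcases le_or_gt t a with h | h
  · simp only [hfa t h, zero_pow (by norm_num : (2 : ℕ) ≠ 0), mul_zero]
  · have hbt : b < t := by
      by_contra hc
      exact ht.2 ⟨h, not_lt.mp hc⟩
    simp only [hfb t hbt.le, zero_pow (by norm_num : (2 : ℕ) ≠ 0), mul_zero]

section measure

variable [MeasurableSpace Circle] [BorelSpace Circle]

variable {lam a b : ℝ} {f : ℝ → ℝ} (hlam : 1 < lam) (hf : ContinuousOn f (Ioi 0))
  (ha : 0 < a) (hab : a ≤ b) (hfa : ∀ s, s ≤ a → f s = 0) (hfb : ∀ s, b ≤ s → f s = 0)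

include hlam hf ha hab hfa hfb in
/-- `∫_a^b sinh 2t (G_λ f)² ≤ ∫_0^∞ sinh 2t (G_λ f)²`. -/
theorem intervalIntegral_sinh_mul_sphGreen_sq_le :
    ∫ t in a..b, Real.sinh (2 * t) * sphGreen lam f a b t ^ 2 ≤ ∫ t in Ioi 0, Real.sinh (2 * t) * sphGreen lam f a b t ^ 2 := by
  rw [integral_of_le hab]
  refine setIntegral_mono_set (integrableOn_sinh_mul_sphGreen_sq hlam hf ha hab hfa hfb) ?_
    (LE.le.eventuallyLE (fun t ht => lt_of_lt_of_le ha ht.1.le))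
  exact ae_restrict_of_forall_mem measurableSet_Ioi (fun t ht =>
    mul_nonneg (Real.sinh_nonneg_iff.mpr (by linarith [Set.mem_Ioi.mp ht])) (sq_nonneg _))

include hlam hf ha hab hfa hfb in
/-- **The resolvent bound** for `λ > 2`: `∫_0^∞ sinh 2t (G_λ f)² ≤ (∫_a^b sinh 2t f²) / (λ(λ−2))²`. -/
theorem integral_sinh_mul_sphGreen_sq_le (h2 : 2 < lam) :
    ∫ t in Ioi 0, Real.sinh (2 * t) * sphGreen lam f a b t ^ 2 ≤ (∫ t in a..b, Real.sinh (2 * t) * f t ^ 2) / (lam * (lam - 2)) ^ 2 := by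
  have hμ : 0 < lam * (lam - 2) := mul_pos (by linarith) (by linarith)
  have hE := energy_identity hlam hf ha hab hfa hfb
  have hA : 0 ≤ ∫ t in Ioi 0, Real.sinh (2 * t) * sphGreen' lam f a b t ^ 2 :=
    setIntegral_nonneg measurableSet_Ioi (fun t ht =>
      mul_nonneg (Real.sinh_nonneg_iff.mpr (by linarith [Set.mem_Ioi.mp ht])) (sq_nonneg _))
  -- the pointwise inequality integrated over `[a, b]`
  have hcu : ContinuousOn (sphGreen lam f a b) (Ioi 0) :=
    fun t ht => (hasDerivAt_sphGreen hlam hf ha hab ht).continuousAt.continuousWithinAt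
  have hcs : ContinuousOn (fun t => Real.sinh (2 * t)) (Ioi 0) :=
    (Real.continuous_sinh.comp (continuous_const.mul continuous_id)).continuousOn
  have hsub : Set.uIcc a b ⊆ Ioi 0 := T5SU11RadialGreen.uIcc_subset_Ioi ha (lt_of_lt_of_le ha hab)
  have hCi : IntervalIntegrable (fun t => Real.sinh (2 * t) * (f t * sphGreen lam f a b t)) volume a b :=
    ((hcs.mul (hf.mul hcu)).mono hsub).intervalIntegrable
  have hBi : IntervalIntegrable (fun t => Real.sinh (2 * t) * sphGreen lam f a b t ^ 2) volume a b :=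
    ((continuousOn_sinh_mul_sphGreen_sq hlam hf ha hab).mono hsub).intervalIntegrable
  have hFi : IntervalIntegrable (fun t => Real.sinh (2 * t) * f t ^ 2) volume a b :=
    ((hcs.mul (hf.pow 2)).mono hsub).intervalIntegrable
  have hpt : ∀ t ∈ Icc a b, -(2 * (lam * (lam - 2))) * (Real.sinh (2 * t) * (f t * sphGreen lam f a b t))
      ≤ (lam * (lam - 2)) ^ 2 * (Real.sinh (2 * t) * sphGreen lam f a b t ^ 2) + Real.sinh (2 * t) * f t ^ 2 := by
    intro t ht
    have hs : 0 ≤ Real.sinh (2 * t) := Real.sinh_nonneg_iff.mpr (by linarith [ht.1])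
    have := mul_le_mul_of_nonneg_left (neg_two_mul_mul_le (lam * (lam - 2)) (f t) (sphGreen lam f a b t)) hs
    linarith [this]
  have hC := integral_mono_on hab (hCi.const_mul _) ((hBi.const_mul _).add hFi) hpt
  rw [intervalIntegral.integral_const_mul, integral_add (hBi.const_mul _) hFi,
    intervalIntegral.integral_const_mul] at hC
  have hBsub := intervalIntegral_sinh_mul_sphGreen_sq_le hlam hf ha hab hfa hfb
  have h3 := mul_le_mul_of_nonneg_left hBsub (sq_nonneg (lam * (lam - 2)))
  have h1 : (lam * (lam - 2)) * ∫ t in Ioi 0, Real.sinh (2 * t) * sphGreen lam f a b t ^ 2 ≤ -∫ t in a..b, Real.sinh (2 * t) * (f t * sphGreen lam f a b t) := by linarith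
  have h4 := mul_le_mul_of_nonneg_left h1 (by linarith : (0 : ℝ) ≤ 2 * (lam * (lam - 2)))
  rw [le_div_iff₀ (pow_pos hμ 2)]
  nlinarith [h3, h4, hC]

include hlam hf ha hab hfa hfb in
/-- **The resolvent bound with both norms over `(0, ∞)`**: `‖G_λ f‖² ≤ ‖f‖² / (λ(λ−2))²` in `L²(sinh 2t dt)`. -/
theorem integral_sinh_mul_sphGreen_sq_le_Ioi (h2 : 2 < lam) :
    ∫ t in Ioi 0, Real.sinh (2 * t) * sphGreen lam f a b t ^ 2 ≤ (∫ t in Ioi 0, Real.sinh (2 * t) * f t ^ 2) / (lam * (lam - 2)) ^ 2 := by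
  rw [integral_Ioi_sinh_mul_sq_eq ha hab hfa hfb]
  exact integral_sinh_mul_sphGreen_sq_le hlam hf ha hab hfa hfb h2

end measure

end Summit.Ventures.HodgeRepro2.T5SU11ResolventBound
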